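import Summits.QuantumFields.YangMills.Theorems.IsotropyFromPowerCountingTemperedCurvatureMomentsThreePointChartBoundsSpectral

/-!
# Three-point chart bounds II: the two-point derivative estimate across a mirror, both planar directions

Support file for stub `stub_threePointChartBounds` (B) of reshape 4 of
`Cruxes/TemperedCurvatureMoments/Lines/Sketch.lean` (crux stmt-QuantumFields-17721, line `Sketch`).
`norm_two_point_iterate_le_sum_of_bound`: for `𝔖` with E2 and translations on `⁰𝒮`, joint spectral measures on
the planar cone and `|𝔖₂ F| ≤ C |F|_M`: `|𝔖₂(f ⊗ ∂_wᴺ g)| ≤ (N/(e δ/2))ᴺ |C| 4^{M+1} 16^M (|f|_M² + |g|_M²)`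
across a gap `δ`, `w ∈ {e₀, e₁}` (explicit constants, so that they are uniform over lattice frames).
References: Osterwalder–Schrader, Comm. Math. Phys. 31 (1973) §4.1, 42 (1975) §4; Glimm–Jaffe, Quantum
Physics (1987) Thm. 6.1.3, §19.5. [folklore]
-/

noncomputable section

open scoped InnerProductSpace ComplexConjugate
open MeasureTheory Filter Set Complex
open _root_.Topology
open Literature.MathematicalPhysics.AQFT Literature.MathematicalPhysics.QuantumLattice
open Literature.MathematicalPhysics.QuantumFieldTheory
open scoped SchwartzMap LineDeriv
open Literature.MathematicalPhysics.QuantumLattice.SchwingerFamily (timeVec)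
open Summit.QuantumFields.YangMills.Theorems.CurvatureKernel
open Summit.QuantumFields.YangMills.Cruxes.PlanarSpectralCone.TwoMirrorLightconeSlots.DiscSections (translateMulti_time_space)

namespace Summit.QuantumFields.YangMills.Theorems.TemperedCurvatureMoments.Sketch.ThreePointChartBounds

/-- **The two-point derivative estimate across the mirror (sum form), both planar directions, explicit
constants.**  For a one-species family `𝔖` on `ℝ⁴` with reflection positivity and translation invariance
on `⁰𝒮` (`h : OSReconstructionNoE1 𝔖.toLabelled`) whose joint spectral measures are carried by the closed
planar cone, and a temperedness bound `|𝔖₂ F| ≤ C |F|_M`: for every `N`, every `0 < δ ≤ 1`, all test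
functions `f` supported in `{y₀ < 0}` and `g` supported in `{y₀ > δ}`, and `w ∈ {e₀, e₁}`,
`|𝔖₂(f ⊗ ∂_wᴺ g)| ≤ (N/(e δ/2))ᴺ · |C| 4^{M+1} 16^M · (|f|_M² + |g|_M²)` (time direction: the chain
`t ↦ (−1)ʲ𝔖₂(f ⊗ (∂₀ʲg₁)(· − te₀))` and `CurvatureKernel.norm_iterDeriv_inner_transfer_le`; space
direction: the chain `b ↦ (−1)ʲ𝔖₂(f ⊗ (∂₁ʲg)(· − be₁))` at `e^{-(δ/2)H}` and
`norm_iterDeriv_inner_transfer_translate_le`). [folklore] -/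
theorem norm_two_point_iterate_le_sum_of_bound (S : SchwingerFamily (EuclideanSpace ℝ (Fin 4)))
    (h : OSReconstructionNoE1 S.toLabelled)
    (hcone : ∀ (ψ : h.Hilbert) (μ : Measure (EuclideanSpace ℝ (Fin 4))),
      h.IsJointSpectralMeasure ψ μ → μ {p | p 0 < |p 1|} = 0)
    (M : ℕ) (C : ℝ) (hS : ∀ F, ‖S 2 F‖ ≤ C * schwartzNorm M F)
    (N : ℕ) {δ : ℝ} (hδ : 0 < δ) (hδ1 : δ ≤ 1) (f g : 𝓢(EuclideanSpace ℝ (Fin 4), ℂ))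
    (hf : tsupport (f : EuclideanSpace ℝ (Fin 4) → ℂ) ⊆ {y | y 0 < 0})
    (hg : tsupport (g : EuclideanSpace ℝ (Fin 4) → ℂ) ⊆ {y | δ < y 0})
    {w : EuclideanSpace ℝ (Fin 4)} (hw : w = EuclideanSpace.single (0 : Fin 4) (1 : ℝ) ∨
      w = EuclideanSpace.single (1 : Fin 4) (1 : ℝ)) :
    ‖S 2 (SchwartzMap.tensorFin 2 ![f,
        ((∂_{w} : 𝓢(EuclideanSpace ℝ (Fin 4), ℂ) → 𝓢(EuclideanSpace ℝ (Fin 4), ℂ))^[N] g)])‖ ≤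
      (N / (Real.exp 1 * (δ / 2))) ^ N *
        (|C| * (2 ^ (M + 1)) ^ 2 * 16 ^ M * (schwartzNorm M f ^ 2 + schwartzNorm M g ^ 2)) := by
  have hS' : ∀ F, ‖S 2 F‖ ≤ |C| * schwartzNorm M F := fun F =>
    (hS F).trans (mul_le_mul_of_nonneg_right (le_abs_self C) (schwartzNorm_nonneg _ _))
  set e₀ : EuclideanSpace ℝ (Fin 4) := EuclideanSpace.single (0 : Fin 4) (1 : ℝ) with he₀
  set e₁ : EuclideanSpace ℝ (Fin 4) := EuclideanSpace.single (1 : Fin 4) (1 : ℝ) with he₁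
  have he₀n : ‖e₀‖ = 1 := by simp [he₀]
  have hδ2 : 0 < δ / 2 := half_pos hδ
  -- the positive-time one-point functions `φ = conj ∘ f ∘ θ` and `g₁ = g(· + δe₀/2)`
  set φ : 𝓢(EuclideanSpace ℝ (Fin 4), ℂ) := starTest (thetaTest 4 f) with hφdef
  set g₁ : 𝓢(EuclideanSpace ℝ (Fin 4), ℂ) := SchwartzMap.compSubConstCLM ℂ (-((δ / 2) • e₀)) g with hg₁def
  have hφ : tsupport (φ : EuclideanSpace ℝ (Fin 4) → ℂ) ⊆ {y | 0 < y 0} :=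
    tsupport_starTest_thetaTest_subset_pos hf
  have hg₁ : tsupport (g₁ : EuclideanSpace ℝ (Fin 4) → ℂ) ⊆ {y | 0 < y 0} := by
    intro y hy
    have h1 := hg (sub_mem_tsupport_of_mem_tsupport_compSubConstCLM _ g hy)
    simp only [mem_setOf_eq, he₀, sub_neg_eq_add] at h1
    have h2 : (y + (δ / 2) • EuclideanSpace.single (0 : Fin 4) (1 : ℝ)) 0 = y 0 + δ / 2 := by simp
    rw [h2] at h1
    show 0 < y 0
    linarith
  have hφT := isTimeOrdered_tensorFin_one hφ
  have hg₁T := isTimeOrdered_tensorFin_one hg₁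
  set ψ₁ : h.Hilbert := h.fieldVec 1 (fun _ => ()) _ hφT with hψ₁
  set ψ₂ : h.Hilbert := h.fieldVec 1 (fun _ => ()) _ hg₁T with hψ₂
  have hback : ∀ b : ℝ, SchwartzMap.compSubConstCLM ℂ ((δ / 2) • e₀ + b • e₁) g₁ =
      SchwartzMap.compSubConstCLM ℂ (b • e₁) g := by
    intro b
    rw [hg₁def, SchwartzMap.compSubConstCLM_comp, neg_add_cancel_left]
  have hg₁back : SchwartzMap.compSubConstCLM ℂ ((δ / 2) • e₀) g₁ = g := by
    rw [hg₁def, SchwartzMap.compSubConstCLM_comp, neg_add_cancel, SchwartzMap.compSubConstCLM_zero]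
    rfl
  -- norms of the field vectors
  have hψ₁n : ‖ψ₁‖ ^ 2 ≤ |C| * (2 ^ (M + 1)) ^ 2 * schwartzNorm M f ^ 2 := by
    refine (norm_fieldVec_sq_le h hφT).trans ?_
    rw [hφdef, starTest_thetaTest_starTest_thetaTest]
    refine (hS' _).trans ?_
    have h1 := schwartzNorm_tensorFin_two_le M f (starTest (thetaTest 4 f))
    have h2 := schwartzNorm_starTest_thetaTest_le M f
    have h3 := schwartzNorm_nonneg M f
    have h4 := schwartzNorm_nonneg M (starTest (thetaTest 4 f))
    calc |C| * schwartzNorm M (SchwartzMap.tensorFin 2 ![f, starTest (thetaTest 4 f)])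
        ≤ |C| * ((2 ^ (M + 1)) ^ 2 * schwartzNorm M f * schwartzNorm M (starTest (thetaTest 4 f))) := by
          gcongr
      _ ≤ |C| * ((2 ^ (M + 1)) ^ 2 * schwartzNorm M f * schwartzNorm M f) := by gcongr
      _ = |C| * (2 ^ (M + 1)) ^ 2 * schwartzNorm M f ^ 2 := by ring
  have hψ₂n : ‖ψ₂‖ ^ 2 ≤ |C| * (2 ^ (M + 1)) ^ 2 * 16 ^ M * schwartzNorm M g ^ 2 := by
    refine (norm_fieldVec_sq_le h hg₁T).trans ((hS' _).trans ?_)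
    have h1 := schwartzNorm_tensorFin_two_le M (starTest (thetaTest 4 g₁)) g₁
    have h2 := schwartzNorm_starTest_thetaTest_le M g₁
    have ha : ‖-((δ / 2) • e₀)‖ ≤ 1 := by
      rw [norm_neg, norm_smul, he₀n, mul_one, Real.norm_of_nonneg (by positivity)]
      linarith
    have h3 : schwartzNorm M g₁ ≤ 4 ^ M * schwartzNorm M g :=
      schwartzNorm_compSubConstCLM_le_of_norm_le_one M ha g
    have h4 := schwartzNorm_nonneg M g
    have h5 := schwartzNorm_nonneg M (starTest (thetaTest 4 g₁))
    have h6 := schwartzNorm_nonneg M g₁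
    calc |C| * schwartzNorm M (SchwartzMap.tensorFin 2 ![starTest (thetaTest 4 g₁), g₁])
        ≤ |C| * ((2 ^ (M + 1)) ^ 2 * schwartzNorm M (starTest (thetaTest 4 g₁)) * schwartzNorm M g₁) := by
          gcongr
      _ ≤ |C| * ((2 ^ (M + 1)) ^ 2 * (4 ^ M * schwartzNorm M g) * (4 ^ M * schwartzNorm M g)) := by
          gcongr
          exact h2.trans h3
      _ = |C| * (2 ^ (M + 1)) ^ 2 * 16 ^ M * schwartzNorm M g ^ 2 := by
          rw [show (16 : ℝ) ^ M = 4 ^ M * 4 ^ M by rw [← mul_pow]; norm_num]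
          ring
  have hsum : ‖ψ₁‖ ^ 2 + ‖ψ₂‖ ^ 2 ≤
      |C| * (2 ^ (M + 1)) ^ 2 * 16 ^ M * (schwartzNorm M f ^ 2 + schwartzNorm M g ^ 2) := by
    have h16 : (1 : ℝ) ≤ 16 ^ M := one_le_pow₀ (by norm_num)
    have h3 := schwartzNorm_nonneg M f
    nlinarith [hψ₁n, hψ₂n, sq_nonneg (schwartzNorm M f), abs_nonneg C]
  have hpos : 0 ≤ (N / (Real.exp 1 * (δ / 2))) ^ N := by positivity
  rcases hw with rfl | rfl
  · -- time direction: the chain in the time-translation parameter (as in the core estimate)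
    set X : 𝓢((Fin 2 → EuclideanSpace ℝ (Fin 4)), ℂ) := SchwartzMap.tensorFin 2 ![f, g₁] with hX
    set w₀ : Fin 2 → EuclideanSpace ℝ (Fin 4) := Pi.single 1 (EuclideanSpace.single (0 : Fin 4) (1 : ℝ))
      with hw₀
    set G : ℕ → ℝ → ℂ := fun j t => (-1 : ℂ) ^ j * S 2 (SchwartzMap.compSubConstCLM ℂ (t • w₀)
      ((∂_{w₀} : 𝓢((Fin 2 → EuclideanSpace ℝ (Fin 4)), ℂ) → 𝓢((Fin 2 → EuclideanSpace ℝ (Fin 4)), ℂ))^[j] X))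
      with hG
    have hGd : ∀ (j : ℕ) (t : ℝ), 0 < t → HasDerivAt (G j) (G (j + 1) t) t := fun j t _ =>
      hasDerivAt_iterate_lineDerivOp_translate (S 2) X w₀ j t
    have hG0 : ∀ t : ℝ, 0 < t → G 0 t = ⟪ψ₁, h.transfer t ψ₂⟫_ℂ := by
      intro t ht
      rw [hψ₁, hψ₂, inner_fieldVec_transfer_eq_tensor_right h hφT hg₁T ht.le, hφdef,
        starTest_thetaTest_starTest_thetaTest]
      simp only [hG, pow_zero, one_mul, Function.iterate_zero, id_eq, hw₀, smul_pi_single_fin_two, hX,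
        compSubConstCLM_single_one_tensorFin_two]
    have hB := norm_iterDeriv_inner_transfer_le h ψ₁ ψ₂ G hG0 hGd N hδ2
    have hGN : G N (δ / 2) = (-1 : ℂ) ^ N * S 2 (SchwartzMap.tensorFin 2 ![f,
        ((∂_{EuclideanSpace.single (0 : Fin 4) (1 : ℝ)} : 𝓢(EuclideanSpace ℝ (Fin 4), ℂ) →
          𝓢(EuclideanSpace ℝ (Fin 4), ℂ))^[N] g)]) := by
      simp only [hG, hw₀, smul_pi_single_fin_two, hX, iterate_lineDerivOp_single_one_tensorFin_two,
        compSubConstCLM_single_one_tensorFin_two, ← iterate_lineDerivOp_compSubConstCLM, ← he₀, hg₁back]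
    have h1 : ‖S 2 (SchwartzMap.tensorFin 2 ![f,
        ((∂_{EuclideanSpace.single (0 : Fin 4) (1 : ℝ)} : 𝓢(EuclideanSpace ℝ (Fin 4), ℂ) →
          𝓢(EuclideanSpace ℝ (Fin 4), ℂ))^[N] g)])‖ = ‖G N (δ / 2)‖ := by
      rw [hGN, norm_mul, norm_pow, norm_neg, norm_one, one_pow, one_mul]
    rw [h1]
    exact hB.trans (mul_le_mul_of_nonneg_left hsum hpos)
  · -- space direction: the chain in the spatial-translation parameter at `e^{-(δ/2)H}`
    set X : 𝓢((Fin 2 → EuclideanSpace ℝ (Fin 4)), ℂ) := SchwartzMap.tensorFin 2 ![f, g] with hX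
    set w : Fin 2 → EuclideanSpace ℝ (Fin 4) := Pi.single 1 e₁ with hw
    set G : ℕ → ℝ → ℂ := fun j b => (-1 : ℂ) ^ j * S 2 (SchwartzMap.compSubConstCLM ℂ (b • w)
      ((∂_{w} : 𝓢((Fin 2 → EuclideanSpace ℝ (Fin 4)), ℂ) → 𝓢((Fin 2 → EuclideanSpace ℝ (Fin 4)), ℂ))^[j] X))
      with hG
    have hGd : ∀ (j : ℕ) (b : ℝ), HasDerivAt (G j) (G (j + 1) b) b := fun j b =>
      hasDerivAt_iterate_lineDerivOp_translate (S 2) X w j b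
    have hH : ∀ b : ℝ, IsAppendTensorOf (SchwartzMap.tensorFin 2 ![starTest (thetaTest 4 φ),
        SchwartzMap.compSubConstCLM ℂ ((δ / 2) • e₀ + b • e₁) g₁])
        (osAdjoint (SchwartzMap.tensorFin 1 ![φ]))
        (translateMulti (timeVec (δ / 2)) (translateMulti (spatialPart 0 (b • e₁))
          (SchwartzMap.tensorFin 1 ![g₁]))) := by
      intro b
      rw [he₁, translateMulti_time_space]
      exact isAppendTensorOf_conjTheta_translate_right φ g₁ _
    have hG0 : ∀ b : ℝ, G 0 b = ⟪ψ₁, h.transfer (δ / 2) (h.translate (b • e₁) ψ₂)⟫_ℂ := by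
      intro b
      rw [hψ₁, hψ₂, h.translate_fieldVec, h.transfer_fieldVec hδ2.le,
        h.inner_fieldVec_fieldVec (fun _ => ()) (fun _ => ()) hφT _ (hH b)]
      simp only [SchwingerFamily.toLabelled_apply, hG, pow_zero, one_mul, Function.iterate_zero, id_eq,
        hw, smul_pi_single_fin_two, hX, compSubConstCLM_single_one_tensorFin_two, hback b, hφdef,
        starTest_thetaTest_starTest_thetaTest]
    have hB := norm_iterDeriv_inner_transfer_translate_le h hcone ψ₁ ψ₂ hδ2 G
      (fun b => by rw [hG0 b, he₁]) hGd N 0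
    have hGN : G N 0 = (-1 : ℂ) ^ N * S 2 (SchwartzMap.tensorFin 2 ![f,
        ((∂_{e₁} : 𝓢(EuclideanSpace ℝ (Fin 4), ℂ) → 𝓢(EuclideanSpace ℝ (Fin 4), ℂ))^[N] g)]) := by
      simp only [hG, zero_smul, SchwartzMap.compSubConstCLM_zero, ContinuousLinearMap.id_apply, hw, hX,
        iterate_lineDerivOp_single_one_tensorFin_two]
    have h1 : ‖S 2 (SchwartzMap.tensorFin 2 ![f,
        ((∂_{e₁} : 𝓢(EuclideanSpace ℝ (Fin 4), ℂ) → 𝓢(EuclideanSpace ℝ (Fin 4), ℂ))^[N] g)])‖ = ‖G N 0‖ := by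
      rw [hGN, norm_mul, norm_pow, norm_neg, norm_one, one_pow, one_mul]
    rw [h1]
    exact hB.trans (mul_le_mul_of_nonneg_left hsum hpos)

end Summit.QuantumFields.YangMills.Theorems.TemperedCurvatureMoments.Sketch.ThreePointChartBounds

end
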